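import Summits.Langlands.Langlands.Theses.RationalPeriodQuarter
import Summits.Langlands.Langlands.Theorems.RationalPeriodQuarterTameDecomposition
import Summits.Langlands.Langlands.Theorems.RationalPeriodQuarterAnalyticCore
import Summits.Langlands.Langlands.Theorems.RationalPeriodQuarterRationalDescent

/-!
# `RationalPeriodQuarter.SemiAnalyticRigidity` (stmt-Langlands-2806) — proved

The crux `SemiAnalyticRigidity` of route `RationalPeriodQuarter` (binder `h₃` of its certified `closes`),
proved by the decomp-langlands lens-1-g38 node `SemiAnalyticRigiditySplit`: the kernel-checked node glue
`TameDecomposition → AnalyticCore → RationalDescent → SemiAnalyticRigidity` with the three children supplied by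
the Mathlib-only theorems `tameDecomposition_statement`, `analyticCore_statement`, `rationalDescent_statement`
(each the child's statement verbatim).  The glue picks `T = [[1,1],[0,1]]` and `γ₀ = [[1,0],[N,1]]` in `Γ₁(N)`
(`CongruenceSubgroup.Gamma1_mem`), evaluates the route's `slashHalf` there, and chains child 1 → 2 → 3.
-/

set_option linter.dupNamespace false

namespace Summit.Langlands.Langlands.Theorems

open scoped BigOperators Topology Matrix
open Filter Set

/-- `RationalPeriodQuarter.SemiAnalyticRigidity` (stmt-Langlands-2806). -/
theorem rationalPeriodQuarter_semiAnalyticRigidity :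
    Summit.Langlands.Langlands.Theses.RationalPeriodQuarter.SemiAnalyticRigidity := by
  intro N hN f hsa hγ
  let IsPRC : (ℝ → ℂ) → Prop := fun φ => ∃ F : Finset ℚ, (∀ a b : ℚ, a < b → (∀ r ∈ F, r ≤ a ∨ b ≤ r) → ∃ (P : Polynomial ℂ) (Q : Polynomial ℚ), ∀ x : ℝ, (a : ℝ) < x → x < b → Polynomial.aeval (x : ℂ) Q ≠ 0 ∧ φ x = Polynomial.eval (x : ℂ) P / Polynomial.aeval (x : ℂ) Q) ∧ ∃ B : ℚ, (∃ (P : Polynomial ℂ) (Q : Polynomial ℚ), ∀ x : ℝ, (B : ℝ) < x → Polynomial.aeval (x : ℂ) Q ≠ 0 ∧ φ x = Polynomial.eval (x : ℂ) P / Polynomial.aeval (x : ℂ) Q) ∧ (∃ (P : Polynomial ℂ) (Q : Polynomial ℚ), ∀ x : ℝ, x < -(B : ℝ) → Polynomial.aeval (x : ℂ) Q ≠ 0 ∧ φ x = Polynomial.eval (x : ℂ) P / Polynomial.aeval (x : ℂ) Q)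
  -- the two group elements
  let T : Matrix.SpecialLinearGroup (Fin 2) ℤ :=
    ⟨!![1, 1; 0, 1], by norm_num [Matrix.det_fin_two_of]⟩
  let γ₀ : Matrix.SpecialLinearGroup (Fin 2) ℤ :=
    ⟨!![1, 0; (N : ℤ), 1], by norm_num [Matrix.det_fin_two_of]⟩
  have hT : T ∈ CongruenceSubgroup.Gamma1 N := by
    rw [CongruenceSubgroup.Gamma1_mem]
    refine ⟨?_, ?_, ?_⟩ <;> simp [T]
  have hγ₀ : γ₀ ∈ CongruenceSubgroup.Gamma1 N := by
    rw [CongruenceSubgroup.Gamma1_mem]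
    refine ⟨?_, ?_, ?_⟩ <;> simp [γ₀]
  -- T-coboundary in explicit form
  have hTf : ∃ q : ℝ → ℂ, IsPRC q ∧ ∀ᶠ t in Filter.cofinite, f (t + 1) - f t = q t := by
    obtain ⟨q, hq, he⟩ := hγ T hT
    refine ⟨q, hq, he.mono fun t ht => ?_⟩
    have h00 : (((T : Matrix (Fin 2) (Fin 2) ℤ) 0 0 : ℤ) : ℝ) = 1 := by simp [T]
    have h01 : (((T : Matrix (Fin 2) (Fin 2) ℤ) 0 1 : ℤ) : ℝ) = 1 := by simp [T]
    have h10 : (((T : Matrix (Fin 2) (Fin 2) ℤ) 1 0 : ℤ) : ℝ) = 0 := by simp [T]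
    have h11 : (((T : Matrix (Fin 2) (Fin 2) ℤ) 1 1 : ℤ) : ℝ) = 1 := by simp [T]
    simp only [h00, h01, h10, h11, zero_mul, zero_add, abs_one, inv_one,
      Complex.ofReal_one, one_mul, div_one] at ht
    exact ht
  -- γ₀-coboundary in explicit form
  have hγ₀f : ∃ q : ℝ → ℂ, IsPRC q ∧ ∀ᶠ t in Filter.cofinite,
      (((|(N : ℝ) * t + 1|⁻¹ : ℝ) : ℂ)) * f (t / ((N : ℝ) * t + 1)) - f t = q t := by
    obtain ⟨q, hq, he⟩ := hγ γ₀ hγ₀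
    refine ⟨q, hq, he.mono fun t ht => ?_⟩
    have h00 : (((γ₀ : Matrix (Fin 2) (Fin 2) ℤ) 0 0 : ℤ) : ℝ) = 1 := by simp [γ₀]
    have h01 : (((γ₀ : Matrix (Fin 2) (Fin 2) ℤ) 0 1 : ℤ) : ℝ) = 0 := by simp [γ₀]
    have h10 : (((γ₀ : Matrix (Fin 2) (Fin 2) ℤ) 1 0 : ℤ) : ℝ) = N := by simp [γ₀]
    have h11 : (((γ₀ : Matrix (Fin 2) (Fin 2) ℤ) 1 1 : ℤ) : ℝ) = 1 := by simp [γ₀]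
    simp only [h00, h01, h10, h11, one_mul, add_zero] at ht
    exact ht
  -- chain the children
  obtain ⟨ρ, hρ, htame⟩ := tameDecomposition_statement f hsa hTf
  obtain ⟨ρ', hρ', hf⟩ := analyticCore_statement N hN f ρ hsa hρ htame hTf hγ₀f
  exact rationalDescent_statement N hN f ⟨ρ', hρ', hf⟩ hγ

end Summit.Langlands.Langlands.Theorems
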